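import Summits.Ventures.PercRepro.S2ThirteenSixSpreadNine
import Summits.Ventures.PercRepro.S2HitTools
import Summits.Ventures.PercRepro.S2TopSixSeven
import Summits.Ventures.PercRepro.S2TopHitSeven
import Summits.Ventures.PercRepro.S2IndepFiveCount
import Summits.Ventures.PercRepro.S2SpreadTail

/-!
# PercRepro — S2: THE ROWS `t ≤ 3` OF THE SPREAD CASE OF THE CELL `(13, 7)` MODULO THE SPREAD CAP `s₄ ≤ 41` (p7, gen 16)

On a coloop-free spread `e`-free core of rank `13` on `20` points (the cell `(13, 7)`), the rows `t ≤ 3` of the triangle count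
close on the `(14, 7)` machinery of gen 14 at `n = 20` plus the gen-16 levers, once the `4`-circuits are capped by `s₄ ≤ 41`
(p1 g33's nullity-`7` spread chain `⌊20·33/16⌋`; here a HYPOTHESIS) — with the GLOBAL caps `s₅ ≤ 312` (**`caps_thirteen_seven_cf`**),
`s₆ ≤ C(12, 6) = 924`: the top `5`-sets are independent `5`-sets (`S2.ncard_indep_five_add_le`) and at `t = 3` meet the union of
the three triangles (`S2.top_five_inter_union_three_nonempty`), the `405` five-sets above a triangle being none of them
(**`S2.ncard_top_five_add_le_of_three_triangles_hit`**); the top `6`-sets by their smallest circuit (`S2.ncard_top_six_le_n`);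
`5·U ≤ 5·U₅ + 7·U₆` (`S2.topCount_mul_five_le_seven`); the spanning sets by the three-circuit Bonferroni
(`S2.ncard_spanning_add_le_of_three_circuits`: `S ≤ 122965 / 114957 / 106949` at `t = 0 / 1 / 2` with three `4`-circuits /
a triangle and two / two triangles and one, `98941` with three triangles). **`c025_thirteen_seven_cf_spread_le_three_of_cap`**:
`(U, S, m) = (30237, 122965, 166), (31053, 114957, 160), (31870, 106949, 153), (32226, 98941, 146)` against
`31772 / 31995 / 32254 / 32513` (`0.952 · 0.971 · 0.988 · 0.991`); the sub-cases with few `4`-circuits on the kit's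
`S = 137980` (`≤ 0.81`). The rows `t ≥ 4`, the concentrated cases and the coloop sub-cells of `(13, 7)` stay OPEN; nothing about
any cell is claimed. Axioms: standard.
-/

open scoped Matroid

namespace PercRepro

namespace S2

open Set

variable {α : Type}

/-- **The top `5`-sets against three triangles they all meet, at `20` points**: `#top5 + 405 + C(|E ∖ (T₁ ∪ T₂ ∪ T₃)|, 5) ≤ C(20, 5)`
(the `3·C(17, 2) − 3` five-sets above a triangle meet the union and are dependent). -/
theorem ncard_top_five_add_le_of_three_triangles_hit (M : Matroid α) [M.Finite]
    (hn : M.E.ncard = 20) (hC1 : ∀ L ⊆ M.E, M.eRk L = 2 → L.ncard ≤ 3)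
    {T₁ T₂ T₃ : Set α} (h₁ : M.IsCircuit T₁) (h₁c : T₁.ncard = 3) (h₂ : M.IsCircuit T₂) (h₂c : T₂.ncard = 3)
    (h₃ : M.IsCircuit T₃) (h₃c : T₃.ncard = 3) (h12 : T₁ ≠ T₂) (h13 : T₁ ≠ T₃) (h23 : T₂ ≠ T₃)
    (hhit : ∀ B ⊆ M.E, B.ncard = 5 → M.eRk (M.E \ B) = M.eRank → (B ∩ (T₁ ∪ T₂ ∪ T₃)).Nonempty) :
    {B : Set α | B ⊆ M.E ∧ B.ncard = 5 ∧ M.eRk B = 5 ∧ M.eRk (M.E \ B) = M.eRank}.ncard + 405 +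
      (M.E \ (T₁ ∪ T₂ ∪ T₃)).ncard.choose 5 ≤ 15504 := by
  classical
  -- the family of `5`-sets meeting `Y = T₁ ∪ T₂ ∪ T₃`
  have hcount := ncard_subsets_inter_nonempty_add_le M.E (T₁ ∪ T₂ ∪ T₃) (T₁ ∪ T₂ ∪ T₃) M.ground_finite 5
  rw [Set.union_self, hn, show (20 : ℕ).choose 5 = 15504 by norm_num [Nat.choose]] at hcount
  set Y := T₁ ∪ T₂ ∪ T₃ with hY
  set Fam := {X : Set α | X ⊆ M.E ∧ X.ncard = 5 ∧ (X ∩ Y).Nonempty ∧ (X ∩ Y).Nonempty} with hFam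
  set Top := {B : Set α | B ⊆ M.E ∧ B.ncard = 5 ∧ M.eRk B = 5 ∧ M.eRk (M.E \ B) = M.eRank} with hTop
  let F : Set α → Set (Set α) := fun T => {X : Set α | X ⊆ M.E ∧ X.ncard = 5 ∧ T ⊆ X}
  have hFamfin : Fam.Finite := M.ground_finite.finite_subsets.subset (fun X hX => hX.1)
  have hFfin : ∀ T, (F T).Finite := fun T => M.ground_finite.finite_subsets.subset (fun X hX => hX.1)
  have hTopfin : Top.Finite := M.ground_finite.finite_subsets.subset (fun X hX => hX.1)
  -- every superset of a triangle lies in the family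
  have hsup : ∀ {T : Set α}, T ⊆ Y → T.ncard = 3 → F T ⊆ Fam := by
    intro T hTY hT3 X ⟨hXE, hX5, hTX⟩
    obtain ⟨z, hz⟩ : T.Nonempty := Set.nonempty_of_ncard_ne_zero (by omega)
    exact ⟨hXE, hX5, ⟨z, hTX hz, hTY hz⟩, ⟨z, hTX hz, hTY hz⟩⟩
  have hF1 := hsup (T := T₁) (Set.subset_union_left.trans Set.subset_union_left) h₁c
  have hF2 := hsup (T := T₂) (Set.subset_union_right.trans Set.subset_union_left) h₂c
  have hF3 := hsup (T := T₃) Set.subset_union_right h₃c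
  -- the top `5`-sets lie in the family, above no triangle
  have hTopFam : Top ⊆ Fam := by
    rintro B ⟨hBE, hB5, -, hBs⟩
    exact ⟨hBE, hB5, hhit B hBE hB5 hBs, hhit B hBE hB5 hBs⟩
  have hdisj : Disjoint Top (F T₁ ∪ F T₂ ∪ F T₃) := by
    rw [Set.disjoint_left]
    rintro B ⟨hBE, hB5, hBr, -⟩ ((hB | hB) | hB)
    · exact not_subset_of_top_five M h₁ hBE hB5 hBr hB.2.2
    · exact not_subset_of_top_five M h₂ hBE hB5 hBr hB.2.2
    · exact not_subset_of_top_five M h₃ hBE hB5 hBr hB.2.2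
  have hunion : Top.ncard + (F T₁ ∪ F T₂ ∪ F T₃).ncard ≤ Fam.ncard := by
    rw [← Set.ncard_union_eq hdisj hTopfin (((hFfin T₁).union (hFfin T₂)).union (hFfin T₃))]
    exact Set.ncard_le_ncard (Set.union_subset hTopFam (Set.union_subset (Set.union_subset hF1 hF2) hF3)) hFamfin
  -- `≥ 136` supersets each
  have hlow : ∀ {T : Set α}, M.IsCircuit T → T.ncard = 3 → 136 ≤ (F T).ncard := by
    intro T hT hTc
    have h := choose_le_ncard_subsets_superset M hT.subset_ground 5 (by omega)
    rw [hn, hTc] at h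
    norm_num [Nat.choose] at h
    exact h
  -- at most one common superset per pair (it would contain the `≥ 5` points of `T ∪ T'`)
  have hinter : ∀ {T T' : Set α}, M.IsCircuit T → T.ncard = 3 → M.IsCircuit T' → T'.ncard = 3 → T ≠ T' →
      (F T ∩ F T').ncard ≤ 1 := by
    intro T T' hT hTc hT' hT'c hne
    have hu5 : 5 ≤ (T ∪ T').ncard := five_le_ncard_union_of_triangles M hC1 hT hTc hT' hT'c hne
    have hsub : F T ∩ F T' ⊆ {X : Set α | X ⊆ M.E ∧ X.ncard = 5 ∧ T ∪ T' ⊆ X} := by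
      rintro X ⟨hX1, hX2⟩
      exact ⟨hX1.1, hX1.2.1, Set.union_subset hX1.2.2 hX2.2.2⟩
    have h := ncard_subsets_superset_le M (Set.union_subset hT.subset_ground hT'.subset_ground) 5
    rw [hn] at h
    have hle := Set.ncard_le_ncard hsub (M.ground_finite.finite_subsets.subset (fun X hX => hX.1))
    have hch : (20 - (T ∪ T').ncard).choose (5 - (T ∪ T').ncard) ≤ 1 := by
      have h0 : 5 - (T ∪ T').ncard = 0 := by omega
      rw [h0, Nat.choose_zero_right]
    omega
  -- Bonferroni on the three superset families
  have hB1 := Set.ncard_union_add_ncard_inter (F T₁) (F T₂) (hFfin T₁) (hFfin T₂)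
  have hB2 := Set.ncard_union_add_ncard_inter (F T₁ ∪ F T₂) (F T₃) ((hFfin T₁).union (hFfin T₂)) (hFfin T₃)
  have hB3 : ((F T₁ ∪ F T₂) ∩ F T₃).ncard ≤ (F T₁ ∩ F T₃).ncard + (F T₂ ∩ F T₃).ncard := by
    rw [Set.union_inter_distrib_right]
    exact Set.ncard_union_le _ _
  have hl1 := hlow h₁ h₁c
  have hl2 := hlow h₂ h₂c
  have hl3 := hlow h₃ h₃c
  have hi12 := hinter h₁ h₁c h₂ h₂c h12
  have hi13 := hinter h₁ h₁c h₃ h₃c h13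
  have hi23 := hinter h₂ h₂c h₃ h₃c h23
  omega

end S2

namespace ThmN

open Set

variable {α : Type}

/-- **The caps of the coloop-free cell `(13, 7)`**: `s₃ ≤ 11`, `s₄ ≤ 57`, `s₅ ≤ 312` (the chains of `caps_fourteen_seven_cf` at
`20` points). -/
theorem caps_thirteen_seven_cf (M : Matroid α) [M.Finite]
    (hd : M.E.encard = M.eRank + ((7 : ℕ) : ℕ∞)) (hn : M.E.ncard = 13 + 7)
    (hfree : ∀ e ∈ M.E, ∃ A ⊆ M.E \ {e}, e ∉ M.closure A ∧ e ∉ M.closure ((M.E \ {e}) \ A)) (hK : ∀ e, ¬ M.IsColoop e) :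
    {C : Set α | M.IsCircuit C ∧ C.ncard = 3}.ncard ≤ 11 ∧
      {C : Set α | M.IsCircuit C ∧ C.ncard = 4}.ncard ≤ 57 ∧
        {C : Set α | M.IsCircuit C ∧ C.ncard = 5}.ncard ≤ 312 := by
  have hs3 := TriangleCap.core_ncard_triangles_le_cq3 M hfree hd
  rw [show TriangleCap.cq3 7 = 11 by decide] at hs3
  have hcol : M.coloops = ∅ := S2.coloops_eq_empty_of_forall_not M hK
  have hm : 20 ≤ (M.E \ M.coloops).ncard := by
    rw [hcol, Set.sdiff_empty, hn]
  have hd' : M.E.encard = M.eRank + (((6 : ℕ) : ℕ∞) + 1) := by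
    rw [hd]; norm_num
  have h := S1.ncard_fourCircuits_sub_div_le_of_nonColoops M hfree hd' (by norm_num) hm (B := 46)
    (fun M' _ hfree' hd'' => by
      have h := ncard_fourCircuits_le_avgChain16 6 M' hfree' hd''
      rw [show avgChain16 6 = 46 by decide] at h
      exact h)
  have hs4 : {C : Set α | M.IsCircuit C ∧ C.ncard = 4}.ncard ≤ 57 := by
    have := S1.le_mul_div_of_sub_div_le (by norm_num : 4 < 20) h
    omega
  have hs5 := S2.ncard_fiveCircuits_le_of_no_coloop M hfree hd' hK (by omega)
  rw [hn] at hs5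
  have h5 : (13 + 7) * S1.avgChain5b 6 / (13 + 7 - 5) = 312 := by
    rw [show S1.avgChain5b 6 = 234 by decide]
  rw [h5] at hs5
  exact ⟨hs3, hs4, hs5⟩

/-- **The rows `t ≤ 3` of the spread case of the coloop-free cell `(13, 7)` modulo the spread cap `s₄ ≤ 41`.** -/
theorem c025_thirteen_seven_cf_spread_le_three_of_cap (M : Matroid α) [M.Finite]
    (hR : M.eRank = ((13 : ℕ) : ℕ∞)) (hn : M.E.ncard = 13 + 7)
    (hfree : ∀ e ∈ M.E, ∃ A ⊆ M.E \ {e}, e ∉ M.closure A ∧ e ∉ M.closure ((M.E \ {e}) \ A)) (hK : ∀ e, ¬ M.IsColoop e)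
    (h4 : ¬ ∃ W ⊆ M.E, W.ncard ≤ 9 ∧ W.encard = M.eRk W + 4)
    (hs4c : {C : Set α | M.IsCircuit C ∧ C.ncard = 4}.ncard ≤ 41)
    (ht3 : {C : Set α | M.IsCircuit C ∧ C.ncard = 3}.ncard ≤ 3) : RLS M 13 5 := by
  classical
  have hd : M.E.encard = M.eRank + ((7 : ℕ) : ℕ∞) := by
    rw [hR, ← M.ground_finite.cast_ncard_eq, hn]
    push_cast
    ring
  obtain ⟨-, -, hs5⟩ := caps_thirteen_seven_cf M hd hn hfree hK
  have hflat : ∀ X ⊆ M.E, M.eRk X ≤ 5 → X.ncard ≤ 8 := fun X hX hr => by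
    have := S2.ncard_le_of_eRk_le_of_not_nullity M 4 9 (by norm_num) h4 hX (r := 5) (by norm_num) (by exact_mod_cast hr)
    omega
  have hflat' : ∀ X ⊆ M.E, M.eRk X ≤ 4 → X.ncard ≤ 7 := fun X hX hr => by
    have := S2.ncard_le_of_eRk_le_of_not_nullity M 4 9 (by norm_num) h4 hX (r := 4) (by norm_num) (by exact_mod_cast hr)
    omega
  have hEcard : M.ground_finite.toFinset.card = 13 + 7 := by
    rw [← Set.ncard_eq_toFinset_card _ M.ground_finite]; exact hn
  have hL0 : ∀ e ∈ M.E, ¬ M.IsLoop e := not_isLoop_of_free M hfree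
  have hs : ∀ e ∈ M.E, ∀ f ∈ M.E, e ≠ f → M.eRk {e, f} = 2 := by
    intro e he f hf hef
    have h2 : (2 : ℕ∞) ≤ M.eRk {e, f} :=
      two_le_eRk_of_two_le_ncard_of_free M hfree (pair_subset he hf) (by rw [ncard_pair hef])
    have h3 : M.eRk {e, f} ≤ 2 := by
      have := M.eRk_le_encard {e, f}
      rwa [encard_pair hef] at this
    exact le_antisymm h3 h2
  have hC1 : ∀ L ⊆ M.E, M.eRk L = 2 → L.ncard ≤ 3 :=
    fun L hL hr => ncard_le_three_of_eRk_two M hs hfree hL hr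
  have hcirc : ∀ C, M.IsCircuit C → 3 ≤ C.encard := three_le_encard_of_circuit M hL0 hs
  have hTfin : {C : Set α | M.IsCircuit C ∧ C.ncard = 3}.Finite :=
    M.ground_finite.finite_subsets.subset (fun C hC => hC.1.subset_ground)
  have h4fin : {C : Set α | M.IsCircuit C ∧ C.ncard = 4}.Finite :=
    M.ground_finite.finite_subsets.subset (fun C hC => hC.1.subset_ground)
  have hs6 : {C : Set α | M.IsCircuit C ∧ C.ncard = 6}.ncard ≤ (7 + 5).choose 6 :=
    Matroid.ncard_circuits_le_choose_of_encard M hd 5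
  norm_num [Nat.choose] at hs6
  have cellA : ∀ (U S m : ℕ) (A : ℚ), Matroid.topCount M 13 5 ≤ U →
      {X : Set α | X ⊆ M.E ∧ M.eRk X = M.eRank}.ncard ≤ S → m ≤ 1024 →
      1024 * (U : ℚ) ≤ ((1024 - m : ℕ) : ℚ) * 2 ^ (7 - 5) * (9480 : ℚ) →
      (1024 : ℚ) * (A + (S : ℚ)) ≤ (m : ℚ) * 2 ^ 20 →
      ({X : Set α | X ⊆ M.E ∧ M.eRk X ≤ 5}.ncard : ℚ) ≤ A → RLS M 13 5 := by
    intro U S m A hU hS hm hpoly htail hA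
    rw [RLS_iff]
    exact c025_core_five_cell_of_counts_xqictq5g M 13 7 (by norm_num) hR hn U hU _ hA S hS
      9480 (by norm_num) (phiK 13 5) (by rw [phiK_thirteen_five]; norm_num) ⟨m, hm, hpoly, htail⟩
  -- the top count through the top `5`- and `6`-sets
  have hUsum := S2.topCount_mul_five_le_seven M hR hd hC1 hflat
  -- the top `5`-sets are independent `5`-sets
  have htop5 : {B : Set α | B ⊆ M.E ∧ B.ncard = 5 ∧ M.eRk B = 5 ∧ M.eRk (M.E \ B) = M.eRank}.ncard ≤
      {B : Set α | B ⊆ M.E ∧ B.ncard = 5 ∧ M.eRk B = 5}.ncard :=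
    Set.ncard_le_ncard (fun B hB => ⟨hB.1, hB.2.1, hB.2.2.1⟩)
      (M.ground_finite.finite_subsets.subset (fun B hB => hB.1))
  have hind5 := S2.ncard_indep_five_add_le (M := M) hC1
  rw [hn] at hind5
  norm_num [Nat.choose] at hind5
  -- the top `6`-sets through circuits, with the per-triangle charge `C(17, 3) = 680`
  have htop6 : {B : Set α | B ⊆ M.E ∧ B.ncard = 6 ∧ M.eRk B = 5 ∧ M.eRk (M.E \ B) = M.eRank}.ncard ≤
      {C : Set α | M.IsCircuit C ∧ C.ncard = 3}.ncard * 680 + {C : Set α | M.IsCircuit C ∧ C.ncard = 4}.ncard * 120 +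
        312 * 15 + 924 := by
    have hc680 : ∀ T : Set α, M.IsCircuit T → T.ncard = 3 →
        {B : Set α | B ⊆ M.E ∧ B.ncard = 6 ∧ T ⊆ B ∧ M.eRk (M.E \ B) = M.eRank}.ncard ≤ 680 := by
      intro T hT hT3
      have hsub : {B : Set α | B ⊆ M.E ∧ B.ncard = 6 ∧ T ⊆ B ∧ M.eRk (M.E \ B) = M.eRank} ⊆
          {X : Set α | X ⊆ M.E ∧ X.ncard = 6 ∧ T ⊆ X} := fun B hB => ⟨hB.1, hB.2.1, hB.2.2.1⟩
      have h := (Set.ncard_le_ncard hsub (M.ground_finite.finite_subsets.subset (fun X hX => hX.1))).trans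
        (S2.ncard_subsets_superset_le M hT.subset_ground 6)
      rw [hn, hT3] at h
      norm_num [Nat.choose] at h
      exact h
    have := S2.ncard_top_six_le_n M hn hcirc 680 hc680
    norm_num [Nat.choose] at this
    have h5' := Nat.mul_le_mul_right 15 hs5
    omega
  -- the spanning counts: the kit, and the three-circuit Bonferroni
  have hSkit : {X : Set α | X ⊆ M.E ∧ M.eRk X = M.eRank}.ncard ≤ 137980 := by
    have hS := Matroid.ncard_spanning_le (M := M) hd
    rw [hEcard] at hS
    exact hS.trans (by decide)
  have hSbonf : ∀ {C₁ C₂ C₃ : Set α}, M.IsCircuit C₁ → M.IsCircuit C₂ → M.IsCircuit C₃ →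
      C₁.ncard ≤ 5 → C₂.ncard ≤ 5 → C₃.ncard ≤ 5 →
      5 ≤ (C₁ ∪ C₂).ncard → 5 ≤ (C₁ ∪ C₃).ncard → 5 ≤ (C₂ ∪ C₃).ncard →
      {X : Set α | X ⊆ M.E ∧ M.eRk X = M.eRank}.ncard +
        (20 - C₁.ncard).choose 7 + (20 - C₂.ncard).choose 7 + (20 - C₃.ncard).choose 7 ≤ 137980 + 3 * 6435 := by
    intro C₁ C₂ C₃ h₁ h₂ h₃ hc₁ hc₂ hc₃ hu12 hu13 hu23
    have a1 := Set.ncard_union_le C₁ C₂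
    have a2 := Set.ncard_union_le C₁ C₃
    have a3 := Set.ncard_union_le C₂ C₃
    have hS := S2.ncard_spanning_add_le_of_three_circuits M hR hn h₁ h₂ h₃ (by omega) (by omega) (by omega)
      (by omega) (by omega) (by omega)
    norm_num [Finset.sum_range_succ, Nat.choose] at hS
    have m12 : (20 - (C₁ ∪ C₂).ncard).choose 7 ≤ 6435 := by
      have := Nat.choose_le_choose 7 (show 20 - (C₁ ∪ C₂).ncard ≤ 15 by omega)
      norm_num [Nat.choose] at this; exact this
    have m13 : (20 - (C₁ ∪ C₃).ncard).choose 7 ≤ 6435 := by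
      have := Nat.choose_le_choose 7 (show 20 - (C₁ ∪ C₃).ncard ≤ 15 by omega)
      norm_num [Nat.choose] at this; exact this
    have m23 : (20 - (C₂ ∪ C₃).ncard).choose 7 ≤ 6435 := by
      have := Nat.choose_le_choose 7 (show 20 - (C₂ ∪ C₃).ncard ≤ 15 by omega)
      norm_num [Nat.choose] at this; exact this
    omega
  -- the exact triangle count `t ≤ 3` and the rank part of the tail at `t` with the caps `41`, `312`
  obtain ⟨t, ht⟩ : ∃ t, {C : Set α | M.IsCircuit C ∧ C.ncard = 3}.ncard = t := ⟨_, rfl⟩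
  have hA := ncard_eRk_le_five_le_spread M 13 7 (by norm_num) hR hn hfree hflat hflat' t 41 312 ht.le hs4c hs5
  rw [ht] at ht3 htop6 hind5
  by_cases ht0 : t = 0
  · subst ht0
    norm_num [Nat.choose] at hind5
    by_cases h43 : 3 ≤ {C : Set α | M.IsCircuit C ∧ C.ncard = 4}.ncard
    · obtain ⟨C₁, C₂, C₃, hC₁, hC₂, hC₃, h12, h13, h23⟩ := (Set.two_lt_ncard_iff h4fin).1 (by omega)
      have e₁ := hC₁.2
      have e₂ := hC₂.2
      have e₃ := hC₃.2
      obtain ⟨-, -, -, b1, -, b3, -, b5, -, -, -, -, -⟩ := S2.three_circuits_ncard_bounds M hC₁.1 hC₂.1 hC₃.1 h12 h13 h23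
      have hS := hSbonf hC₁.1 hC₂.1 hC₃.1 (by omega) (by omega) (by omega) (by omega) (by omega) (by omega)
      rw [hC₁.2, hC₂.2, hC₃.2] at hS
      norm_num [Nat.choose] at hS
      have hU' : Matroid.topCount M 13 5 ≤ 30237 := by omega
      exact cellA _ 122965 166 _ hU' (by omega) (by norm_num) (by norm_num) (by norm_num [Nat.choose]) hA
    · push Not at h43
      have hU' : Matroid.topCount M 13 5 ≤ 23685 := by omega
      exact cellA _ 137980 181 _ hU' hSkit (by norm_num) (by norm_num) (by norm_num [Nat.choose]) hA
  by_cases ht1 : t = 1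
  · subst ht1
    norm_num [Nat.choose] at hind5
    obtain ⟨T, hTeq⟩ := Set.ncard_eq_one.1 ht
    have hT : M.IsCircuit T ∧ T.ncard = 3 := by
      have : T ∈ {C : Set α | M.IsCircuit C ∧ C.ncard = 3} := by rw [hTeq]; exact Set.mem_singleton T
      exact this
    by_cases h42 : 2 ≤ {C : Set α | M.IsCircuit C ∧ C.ncard = 4}.ncard
    · obtain ⟨C₁, C₂, hC₁, hC₂, hne⟩ := (Set.one_lt_ncard_iff h4fin).1 (by omega)
      have hne₁ : T ≠ C₁ := fun h => by have h3 := hT.2; rw [h, hC₁.2] at h3; omega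
      have hne₂ : T ≠ C₂ := fun h => by have h3 := hT.2; rw [h, hC₂.2] at h3; omega
      have e₁ := hT.2
      have e₂ := hC₁.2
      have e₃ := hC₂.2
      obtain ⟨-, -, -, -, b2, -, b4, -, b6, -, -, -, -⟩ := S2.three_circuits_ncard_bounds M hT.1 hC₁.1 hC₂.1 hne₁ hne₂ hne
      have hS := hSbonf hT.1 hC₁.1 hC₂.1 (by omega) (by omega) (by omega) (by omega) (by omega) (by omega)
      rw [hT.2, hC₁.2, hC₂.2] at hS
      norm_num [Nat.choose] at hS
      have hU' : Matroid.topCount M 13 5 ≤ 31053 := by omega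
      exact cellA _ 114957 160 _ hU' (by omega) (by norm_num) (by norm_num) (by norm_num [Nat.choose]) hA
    · push Not at h42
      have hU' : Matroid.topCount M 13 5 ≤ 24333 := by omega
      exact cellA _ 137980 182 _ hU' hSkit (by norm_num) (by norm_num) (by norm_num [Nat.choose]) hA
  by_cases ht2 : t = 2
  · subst ht2
    norm_num [Nat.choose] at hind5
    obtain ⟨T₁, T₂, hT₁, hT₂, hne⟩ := (Set.one_lt_ncard_iff hTfin).1 (by omega)
    by_cases h41 : 1 ≤ {C : Set α | M.IsCircuit C ∧ C.ncard = 4}.ncard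
    · obtain ⟨Q, hQ⟩ := Set.nonempty_of_ncard_ne_zero (s := {C : Set α | M.IsCircuit C ∧ C.ncard = 4}) (by omega)
      have hne₁ : T₁ ≠ Q := fun h => by have h3 := hT₁.2; rw [h, hQ.2] at h3; omega
      have hne₂ : T₂ ≠ Q := fun h => by have h3 := hT₂.2; rw [h, hQ.2] at h3; omega
      have e₁ := hT₁.2
      have e₂ := hT₂.2
      have e₃ := hQ.2
      obtain ⟨-, -, -, -, -, -, b4, -, b6, -, -, -, -⟩ := S2.three_circuits_ncard_bounds M hT₁.1 hT₂.1 hQ.1 hne hne₁ hne₂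
      have hu12 := S2.five_le_ncard_union_of_triangles M hC1 hT₁.1 hT₁.2 hT₂.1 hT₂.2 hne
      have hS := hSbonf hT₁.1 hT₂.1 hQ.1 (by omega) (by omega) (by omega) hu12 (by omega) (by omega)
      rw [hT₁.2, hT₂.2, hQ.2] at hS
      norm_num [Nat.choose] at hS
      have hU' : Matroid.topCount M 13 5 ≤ 31870 := by omega
      exact cellA _ 106949 153 _ hU' (by omega) (by norm_num) (by norm_num) (by norm_num [Nat.choose]) hA
    · push Not at h41
      have hU' : Matroid.topCount M 13 5 ≤ 24982 := by omega
      exact cellA _ 137980 183 _ hU' hSkit (by norm_num) (by norm_num) (by norm_num [Nat.choose]) hA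
  -- `t = 3`: the three triangles
  have ht3e : t = 3 := by omega
  subst ht3e
  obtain ⟨T₁, T₂, T₃, hT₁, hT₂, hT₃, h12, h13, h23⟩ := (Set.two_lt_ncard_iff hTfin).1 (by omega)
  have hhit := S2.top_five_inter_union_three_nonempty M hR hn hC1 hT₁.1 hT₁.2 hT₂.1 hT₂.2 hT₃.1 hT₃.2 h12 h13 h23
  have h5b := S2.ncard_top_five_add_le_of_three_triangles_hit M hn hC1 hT₁.1 hT₁.2 hT₂.1 hT₂.2 hT₃.1 hT₃.2 h12 h13 h23 hhit
  have e₁ := hT₁.2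
  have e₂ := hT₂.2
  have e₃ := hT₃.2
  have hY : T₁ ∪ T₂ ∪ T₃ ⊆ M.E :=
    Set.union_subset (Set.union_subset hT₁.1.subset_ground hT₂.1.subset_ground) hT₃.1.subset_ground
  have hc := Set.ncard_sdiff_add_ncard_of_subset hY M.ground_finite
  have hu : (T₁ ∪ T₂ ∪ T₃).ncard ≤ 9 := by
    have h1 := Set.ncard_union_le (T₁ ∪ T₂) T₃
    have h2 := Set.ncard_union_le T₁ T₂
    omega
  have hch : 462 ≤ (M.E \ (T₁ ∪ T₂ ∪ T₃)).ncard.choose 5 :=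
    calc 462 = (11 : ℕ).choose 5 := by norm_num [Nat.choose]
      _ ≤ (M.E \ (T₁ ∪ T₂ ∪ T₃)).ncard.choose 5 := Nat.choose_le_choose 5 (by omega)
  have hS := S2.ncard_spanning_add_le_of_three_triangles M hR hn (by norm_num) hC1 hT₁.1 hT₁.2 hT₂.1 hT₂.2
    hT₃.1 hT₃.2 h12 h13 h23
  norm_num [Finset.sum_range_succ, Nat.choose] at hS
  have hU' : Matroid.topCount M 13 5 ≤ 32226 := by omega
  exact cellA _ 98941 146 _ hU' (by omega) (by norm_num) (by norm_num) (by norm_num [Nat.choose]) hA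

end ThmN

end PercRepro
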